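import Summits.ResolutionOfSingularities.ResolutionOfSingularities.Theorems.EquisingularLiftEquisingularLiftNatLineBundleSectionHom
import Literature.AlgebraicGeometry.Modules.FrameMatrixEnd
import HarnessLib

/-!
# [OURS · L1 W4.5b · T-DIRLIFT-UP route C, bricks B2–B4 of C1c] Reframing to a basis, functionals of unimodular combinations, and
# local-to-global proportionality of a line of sections

Cell res-hironaka, LADDER-RESOLUTION rung L, slot W4.5(b), crux chain w45b (EL♮(3) = stmt-ResolutionOfSingularities-20148); object
T-DIRLIFT-UP (res-L1-w45b-plan-1 RULING 19:14:55Z, route C), brick C1c (`L/res-D-pv-051/TARGET-C1c.sig.lean` b928b225abc4a457),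
sub-bricks B2–B4 (generic `𝒪_Y`-module statements; the scheme-specific production B5–B7 consumes them).
`--supports stmt-ResolutionOfSingularities-20148 --as helper`. THEOREMS ONLY; def-free; NOT a statement of any manuscript; AI-written,
AI review weaker than expert review.

WHAT. For an `𝒪_Y`-module `G` with a frame `e₀ : 𝒪^I ≅ G|_W` (`I` finite):
* B2 `exists_frame_of_basis`: any `Γ(Y, W)`-BASIS `b` of `Γ(G, W)` is the family of basis sections of SOME frame `e : 𝒪^I ≅ G|_W`
  (`e := e₀ ≫ matrixEnd P`, `P` = coordinates of `b` in `e₀`, inverse `Q` = coordinates of `e₀` in `b`; Hartshorne II.5 change of basis) —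
  used with C1d (`Literature…RegularImmersionConormalBasis`, p564232 ✓) to get conormal FRAMES whose basis sections ARE the pulled-back
  generators;
* B3 `exists_functional_of_unimodular_comb`: over `U ≤ W`, a combination `w = Σ a_i b_i|_U` with `Σ r_i a_i = 1` has a functional
  `ρ : G|_U → 𝒪|_U` with `ρ(w) = 1` (C1a p562805 `exists_functional_of_unimodular_coords` in the restricted frame);
* B4 `hprop_of_locally`: a family `w_z ∈ Γ(G, U_z)` with functionals `ρ_z(w_z) = 1` that is LOCALLY proportional on overlaps is
  proportional on every open below two members — C1b's (p563530 ✓) hypothesis `hprop` — with factor `u = ρ_z(w_{z'}|)` (sheaf condition).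
References (method): Hartshorne II.5 (p. 109, change of basis), II Ex. 5.1, II Ex. 1.22 (glueing).
-/

noncomputable section

open CategoryTheory AlgebraicGeometry Opposite TopologicalSpace
open Literature.AlgebraicGeometry.Modules Literature.AlgebraicGeometry.Motives

set_option linter.dupNamespace false -- mandated namespace `Summit.<Summit>.<Problem>` of this single-conjunct summit

namespace Summit.ResolutionOfSingularities.ResolutionOfSingularities.Cruxes.EquisingularLiftNat.P1VB

universe u

variable {Y : Scheme.{u}} {G : Y.Modules} {W : Y.Opens} {I : Type u}

/-! ## B2. Reframing to a basis of the sections -/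

/-- Basis sections of a frame followed by an automorphism of `G|_W` are the images of the basis sections. [folklore] -/
theorem basisSection_trans_iso (e₀ : SheafOfModules.free I ≅ G.over W) (f : G.over W ≅ G.over W) (i : I) :
    basisSection (e₀ ≪≫ f) i = appLE f.hom (𝟙 W) (basisSection e₀ i) := by
  rw [basisSection, Iso.trans_hom, SheafOfModules.freeHomEquiv_comp_apply, overSectionsEquiv_sectionsMap']
  rfl

/-- **Reframing to a basis.** If `G|_W` has a frame `e₀ : 𝒪^I ≅ G|_W` (`I` finite) and `b` is any basis of the `Γ(Y, W)`-module
`Γ(G, W)` indexed by `I`, then some frame `e : 𝒪^I ≅ G|_W` has basis sections `b`: `e := e₀ ≫ (matrix P)`, `P_{ml} = λ_m(b_l)`, with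
inverse the matrix `Q_{ml} = (b.repr b⁰_l)_m`. [cite: Hartshorne1977, II.5 (p. 109)] -/
theorem exists_frame_of_basis [Fintype I] (e₀ : SheafOfModules.free I ≅ G.over W) (b : Module.Basis I Γ(Y, W) Γ(G, W)) :
    ∃ e : SheafOfModules.free I ≅ G.over W, ∀ i, basisSection e i = b i := by
  classical
  let P : Matrix I I Γ(Y, W) := Matrix.of fun m l => coord e₀ (𝟙 W) (b l) m
  let Q : Matrix I I Γ(Y, W) := Matrix.of fun m l => b.repr (basisSection e₀ l) m
  -- `b_l = Σ_m P_{ml} b⁰_m` and `b⁰_l = Σ_m Q_{ml} b_m`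
  have hPb : ∀ l, ∑ m, P m l • basisSection e₀ m = b l := by
    intro l
    have h := eq_sum_coord_smul e₀ (𝟙 W) (b l)
    simp_rw [presheaf_map_id] at h
    exact h.symm
  have hQb : ∀ l, ∑ m, Q m l • b m = basisSection e₀ l := fun l => b.sum_repr (basisSection e₀ l)
  have hPQ : P * Q = 1 := by
    ext m l
    rw [Matrix.mul_apply, Matrix.one_apply]
    have h1 : ∑ j, P m j * Q j l = coord e₀ (𝟙 W) (∑ j, Q j l • b j) m := by
      rw [coord_sum]
      refine Finset.sum_congr rfl fun j _ => ?_
      rw [coord_smul, mul_comm]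
      rfl
    rw [h1, hQb, coord_basisSection]
    split_ifs with h h' h' <;> first | rfl | exact absurd h.symm h' | exact absurd h'.symm h
  have hQP : Q * P = 1 := by
    ext m l
    rw [Matrix.mul_apply, Matrix.one_apply]
    have h1 : ∑ j, Q m j * P j l = b.repr (∑ j, P j l • basisSection e₀ j) m := by
      rw [map_sum, Finsupp.coe_finsetSum, Finset.sum_apply]
      refine Finset.sum_congr rfl fun j _ => ?_
      rw [map_smul, Finsupp.coe_smul, Pi.smul_apply, smul_eq_mul, mul_comm]
      rfl
    rw [h1, hPb, b.repr_self, Finsupp.single_apply]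
    split_ifs with h h' h' <;> first | rfl | exact absurd h.symm h' | exact absurd h'.symm h
  let f : G.over W ≅ G.over W :=
    { hom := matrixEnd e₀ (𝟙 W) P
      inv := matrixEnd e₀ (𝟙 W) Q
      hom_inv_id := by rw [matrixEnd_comp, hQP, matrixEnd_one]
      inv_hom_id := by rw [matrixEnd_comp, hPQ, matrixEnd_one] }
  refine ⟨e₀ ≪≫ f, fun i => ?_⟩
  rw [basisSection_trans_iso]
  change appLE (matrixEnd e₀ (𝟙 W) P) (𝟙 W) (basisSection e₀ i) = b i
  have h := appLE_matrixEnd_basisSection e₀ (𝟙 W) P i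
  simp_rw [presheaf_map_id] at h
  rw [h]
  exact hPb i

/-! ## B3. The functional of a unimodular combination of basis sections -/

/-- **Unimodular combinations of basis sections have functionals.** For a frame `e : 𝒪^I ≅ G|_W`, `U ≤ W`, coefficients
`a : I → Γ(Y, U)` and `r` with `Σ_i r_i a_i = 1`, the section `w := Σ_i a_i · b_i|_U` has a functional `ρ : G|_U → 𝒪|_U` with
`ρ(w) = 1` (`ρ = Σ r_i λ_i` in the restricted frame). [cite: Hartshorne1977, II Ex. 5.1] -/
theorem exists_functional_of_unimodular_comb [Fintype I] (e : SheafOfModules.free I ≅ G.over W) {U : Y.Opens} (k : U ⟶ W)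
    (a r : I → Γ(Y, U)) (hr : ∑ i, r i * a i = 1) :
    ∃ ρ : G.over U ⟶ (unitModule Y).over U,
      @Eq Γ(Y, U) (appLE ρ (𝟙 U) (∑ i, a i • G.presheaf.map k.op (basisSection e i))) 1 := by
  refine exists_functional_of_unimodular_coords (SheafOfModules.restrictTrivialisation (R := Y.ringCatSheaf) k e) _ r ?_
  have hc : ∀ i, coord (SheafOfModules.restrictTrivialisation (R := Y.ringCatSheaf) k e) (𝟙 U)
      (∑ j, a j • G.presheaf.map k.op (basisSection e j)) i = a i := by
    intro i
    rw [coord_restrictTrivialisation, Category.id_comp]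
    exact coord_sum_smul_basisSection e k a i
  simp_rw [hc]
  exact hr

/-! ## B4. Local proportionality with functionals is global proportionality -/

/-- **Local ⇒ global proportionality.** Sections `w_z ∈ Γ(G, U_z)` with functionals `ρ_z(w_z) = 1`; if around every point of
`U_z ∩ U_{z'}` one has `w_{z'} = u' · w_z` on some neighbourhood, then on EVERY open `V` below `U_z` and `U_{z'}`,
`w_{z'}|_V = u · w_z|_V` with `u := ρ_z(w_{z'}|_V)` (compare the two sections locally: there `u| = ρ_z(u' w_z) = u'`).
This is the hypothesis `hprop` of C1b's `proportionalCocycle`. [cite: Hartshorne1977, II Ex. 1.22] -/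
theorem hprop_of_locally {U : Y → Y.Opens} (w : ∀ z, Γ(G, U z)) (ρ : ∀ z, G.over (U z) ⟶ (unitModule Y).over (U z))
    (hρ : ∀ z, @Eq Γ(Y, U z) (appLE (ρ z) (𝟙 (U z)) (w z)) 1)
    (hloc : ∀ (z z' y : Y), y ∈ U z → y ∈ U z' →
      ∃ (V' : Y.Opens) (_ : y ∈ V') (hz : V' ≤ U z) (hz' : V' ≤ U z') (u : Γ(Y, V')),
        G.presheaf.map (homOfLE hz').op (w z') = u • G.presheaf.map (homOfLE hz).op (w z))
    (z z' : Y) (V : Y.Opens) (hz : V ≤ U z) (hz' : V ≤ U z') :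
    ∃ u : Γ(Y, V), G.presheaf.map (homOfLE hz').op (w z') = u • G.presheaf.map (homOfLE hz).op (w z) := by
  refine ⟨(appLE (ρ z) (homOfLE hz) (G.presheaf.map (homOfLE hz').op (w z')) : Γ(unitModule Y, V)), ?_⟩
  -- the local neighbourhoods
  choose V' hyV' hVz hVz' u' hu' using fun y : V => hloc z z' y.1 (hz y.2) (hz' y.2)
  refine TopCat.Sheaf.eq_of_locally_eq' ((SheafOfModules.toSheaf _).obj G) (fun y : V => V ⊓ V' y) V
    (fun y => Opens.infLELeft _ _) ?_ _ _ fun y => ?_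
  · intro x hx
    exact Opens.mem_iSup.2 ⟨⟨x, hx⟩, hx, hyV' ⟨x, hx⟩⟩
  · -- on `V ⊓ V'_y`: `w_{z'}| = u'| • w_z|` and `u| = ρ_z(w_{z'}|)| = ρ_z(u' • w_z|) = u'|`
    have hle : V ⊓ V' y ≤ V' y := inf_le_right
    -- restrict the local relation to `V ⊓ V'_y`
    have hloc' : G.presheaf.map (Opens.infLELeft V (V' y) ≫ homOfLE hz').op (w z') =
        Y.presheaf.map (homOfLE hle).op (u' y) • G.presheaf.map (Opens.infLELeft V (V' y) ≫ homOfLE hz).op (w z) := by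
      rw [Subsingleton.elim (Opens.infLELeft V (V' y) ≫ homOfLE hz') (homOfLE hle ≫ homOfLE (hVz' y)),
        Subsingleton.elim (Opens.infLELeft V (V' y) ≫ homOfLE hz) (homOfLE hle ≫ homOfLE (hVz y)), op_comp, op_comp,
        G.presheaf.map_comp, G.presheaf.map_comp]
      change G.presheaf.map (homOfLE hle).op (G.presheaf.map (homOfLE (hVz' y)).op (w z')) =
        _ • G.presheaf.map (homOfLE hle).op (G.presheaf.map (homOfLE (hVz y)).op (w z))
      rw [hu' y, Scheme.Modules.map_smul]
    -- `ρ_z(w_z|) = 1|`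
    have h2' : @Eq Γ(Y, V ⊓ V' y) (appLE (ρ z) (Opens.infLELeft V (V' y) ≫ homOfLE hz)
        (G.presheaf.map (Opens.infLELeft V (V' y) ≫ homOfLE hz).op (w z))) 1 := by
      have h2 := appLE_map (ρ z) (𝟙 (U z)) (Opens.infLELeft V (V' y) ≫ homOfLE hz) (w z)
      rw [Category.comp_id] at h2
      have h2'' : @Eq Γ(Y, V ⊓ V' y) (appLE (ρ z) (Opens.infLELeft V (V' y) ≫ homOfLE hz)
          (G.presheaf.map (Opens.infLELeft V (V' y) ≫ homOfLE hz).op (w z)))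
          (Y.presheaf.map (Opens.infLELeft V (V' y) ≫ homOfLE hz).op (appLE (ρ z) (𝟙 (U z)) (w z) : Γ(Y, U z))) := h2
      rw [h2'', hρ z, map_one]
    have h3 : ∀ t : Γ(Y, V ⊓ V' y), @Eq Γ(Y, V ⊓ V' y) (appLE (ρ z) (Opens.infLELeft V (V' y) ≫ homOfLE hz)
        (G.presheaf.map (Opens.infLELeft V (V' y) ≫ homOfLE hz).op (w z))) t →
        (Y.presheaf.map (homOfLE hle).op (u' y) • appLE (ρ z) (Opens.infLELeft V (V' y) ≫ homOfLE hz)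
          (G.presheaf.map (Opens.infLELeft V (V' y) ≫ homOfLE hz).op (w z)) : Γ(unitModule Y, V ⊓ V' y)) =
          Y.presheaf.map (homOfLE hle).op (u' y) * t := by
      intro t ht; rw [← ht]; rfl
    -- the factor restricted: `u|_{V ⊓ V'_y} = u'_y|_{V ⊓ V'_y}`
    have hu_eq : (Y.presheaf.map (Opens.infLELeft V (V' y)).op
        (appLE (ρ z) (homOfLE hz) (G.presheaf.map (homOfLE hz').op (w z')) : Γ(unitModule Y, V)) : Γ(Y, V ⊓ V' y)) =
        Y.presheaf.map (homOfLE hle).op (u' y) := by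
      have h1 := appLE_map (ρ z) (homOfLE hz) (Opens.infLELeft V (V' y)) (G.presheaf.map (homOfLE hz').op (w z'))
      have h1' : (Y.presheaf.map (Opens.infLELeft V (V' y)).op
          (appLE (ρ z) (homOfLE hz) (G.presheaf.map (homOfLE hz').op (w z')) : Γ(unitModule Y, V)) : Γ(Y, V ⊓ V' y)) =
          appLE (ρ z) (Opens.infLELeft V (V' y) ≫ homOfLE hz)
            (G.presheaf.map (Opens.infLELeft V (V' y)).op (G.presheaf.map (homOfLE hz').op (w z'))) := h1.symm
      rw [h1', presheaf_map_map, hloc', appLE_smul_right, h3 1 h2', mul_one]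
    change G.presheaf.map (Opens.infLELeft V (V' y)).op (G.presheaf.map (homOfLE hz').op (w z')) =
      G.presheaf.map (Opens.infLELeft V (V' y)).op (_ • G.presheaf.map (homOfLE hz).op (w z))
    rw [Scheme.Modules.map_smul, presheaf_map_map, presheaf_map_map, hloc']
    exact congrArg (· • _) hu_eq.symm

end Summit.ResolutionOfSingularities.ResolutionOfSingularities.Cruxes.EquisingularLiftNat.P1VB

end
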